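import Mathlib
import Literature.Analysis.FluidPDE.BiotSavartBounds
import Literature.Analysis.FluidPDE.CylindricalIntegration
import Summits.NavierStokesRegularity.NavierStokesRegularity.Theses.SlicedKelvin

/-!
# Crux `SlicedKelvin.FluxZoom` (stmt-NavierStokesRegularity-15603), line `registered`,
# stub `stub_nearFieldFlux`: the near-field Biot–Savart integral at bounded planar flux

Support file (theorems only, `--supports stmt-NavierStokesRegularity-15603`) for the lead's
skeleton of the crux `FluxZoom` of route `SlicedKelvin`. The kernel estimate behind the
velocity bound `‖u‖²_∞ ≲ ‖ω‖_∞ · Φ` of the vorticity-normalised zoom: for a continuous field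
`ω : ℝ³ → ℝ³` with `|ω| ≤ W` and unsigned flux `∫_Π |ω · n| ≤ Φ` through every plane `Π`
(stated for the images `R {y₂ = c}` of the coordinate planes under linear isometries `R`, with
normal `R e₂`), every `x ∈ ℝ³` and every `0 < r ≤ 1`,

  `y ↦ |ω(y)| / |x − y|²` is integrable on `B(x, 2)` and
  `∫_{B(x,2)} |ω(y)| / |x − y|² dy ≤ 4π r W + 12 Φ / r`.

## Proof

All in lower Lebesgue integrals, converted at the end (`integral_eq_lintegral_of_nonneg_ae`).

* Integrability: on `B(x, 2)` the integrand is dominated by `W · 1_{|x−y|<2} |x − y|⁻²`, a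
  translate of the integrable majorant `kernelMajorant 2` of `BiotSavartBounds`.
* Pointwise splitting (`div_norm_sq_le`): for every `y`,
  `|ω(y)|/|x−y|² ≤ W · kernelMajorant r (x − y) + Σᵢ (max(|yᵢ − xᵢ|, r))⁻² |ωᵢ(y)|`:
  inside `B(x, r)` the first term dominates; outside, `|ω| ≤ Σᵢ |ωᵢ|` (Euclidean norm `≤ ℓ¹`
  norm) and `|x − y| ≥ max(|yᵢ − xᵢ|, r)` for each coordinate `i`.
* Inner ball: `∫ W · kernelMajorant r (x − ·) = 4π r W` (`lintegral_kernelMajorant`, polar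
  coordinates, already in the tree).
* Slicing (`lintegral_slice_le`): for a measurable weight `k ≥ 0` of one coordinate,
  `∫ k(yᵢ) |ωᵢ(y)| dy ≤ (∫ k) · Φ`. The coordinates `i` and `2` are exchanged by the linear
  isometry `R = piLpCongrLeft (swap i 2)` (volume preserving, `R e₂ = eᵢ`, `(R z)ᵢ = z₂`), the
  variables are split as `z = (w₀, w₁, t)` by the volume-preserving `cylSplit` of
  `CylindricalIntegration`, Tonelli (`lintegral_prod_le`) gives
  `∫ k(t) (∫_w |ωᵢ(R(w₀, w₁, t))|) dt`, and the inner integral is the flux of `ω` through the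
  plane `R {y₂ = t}`, at most `Φ` by hypothesis (`⟪v, eᵢ⟫ = vᵢ`).
* The one-dimensional weight: `∫_ℝ (max(|h|, r))⁻² dh = 2/r + 1/r + 1/r = 4/r`
  (`lintegral_inv_max_sq_le`: the pieces `[−r, r]`, `(r, ∞)` — Mathlib's
  `integral_Ioi_rpow_of_lt` — and its mirror image, `lintegral_neg_eq_self`).
* Assembly: `4π r W + 3 · (4/r) · Φ`.

No named fact is assumed: every ingredient is a theorem of Mathlib or of the tree
(`Literature.Analysis.FluidPDE.BiotSavartBounds`, `.CylindricalIntegration`).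

## References

* A. J. Majda, A. L. Bertozzi, *Vorticity and Incompressible Flow* (CUP 2002), §4.1.3 (the
  potential-theory estimate for the Biot–Savart kernel) [MajdaBertozziCUP2002].
-/

noncomputable section

-- the summit and its single sub-problem share the name (CONVENTIONS §1), as in every Theorems file
set_option linter.dupNamespace false

open MeasureTheory Set Function Filter Topology Metric Real WithLp
open scoped ENNReal NNReal RealInnerProductSpace

namespace Summit.NavierStokesRegularity.NavierStokesRegularity.Theorems.FluxZoom.Registered

open Literature.Analysis.FluidPDE

/-! ### Pointwise splitting of the kernel -/

/-- A coordinate is bounded by the Euclidean norm: `|vᵢ| ≤ ‖v‖`. -/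
private theorem abs_apply_le_norm (v : EuclideanSpace ℝ (Fin 3)) (i : Fin 3) : |v i| ≤ ‖v‖ := by
  have h := PiLp.norm_apply_le v i
  rwa [Real.norm_eq_abs] at h

/-- The Euclidean norm is bounded by the `ℓ¹` norm: `‖v‖ ≤ Σᵢ |vᵢ|` on `ℝ³`. -/
private theorem norm_le_sum_abs (v : EuclideanSpace ℝ (Fin 3)) : ‖v‖ ≤ ∑ i, |v i| := by
  rw [EuclideanSpace.norm_eq, Fin.sum_univ_three, Fin.sum_univ_three]
  simp only [Real.norm_eq_abs, sq_abs]
  rw [Real.sqrt_le_left (by positivity)]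
  nlinarith [sq_abs (v 0), sq_abs (v 1), sq_abs (v 2),
    mul_nonneg (abs_nonneg (v 0)) (abs_nonneg (v 1)),
    mul_nonneg (abs_nonneg (v 0)) (abs_nonneg (v 2)),
    mul_nonneg (abs_nonneg (v 1)) (abs_nonneg (v 2))]

/-- **Pointwise splitting.** For `|ω| ≤ W`, `0 ≤ W`, `0 < r` and all `x, y`:
`|ω(y)|/|x−y|² ≤ W · kernelMajorant r (x − y) + Σᵢ (max(|yᵢ − xᵢ|, r))⁻² |ωᵢ(y)|` (inside the
ball `|x − y| < r` the first term dominates; outside, `|ω| ≤ Σᵢ|ωᵢ|` and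
`|x − y| ≥ max(|yᵢ − xᵢ|, r)`). At the junk point `y = x` the left side is `0`. -/
private theorem div_norm_sq_le {ω : EuclideanSpace ℝ (Fin 3) → EuclideanSpace ℝ (Fin 3)}
    {W r : ℝ} (hr : 0 < r) (hW : 0 ≤ W) (hbound : ∀ y, ‖ω y‖ ≤ W)
    (x y : EuclideanSpace ℝ (Fin 3)) :
    ‖ω y‖ / ‖x - y‖ ^ 2 ≤
      W * kernelMajorant r (x - y) + ∑ i, ((max |y i - x i| r) ^ 2)⁻¹ * |ω y i| := by
  have hsum0 : 0 ≤ ∑ i, ((max |y i - x i| r) ^ 2)⁻¹ * |ω y i| :=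
    Finset.sum_nonneg fun i _ => by positivity
  by_cases h : ‖x - y‖ < r
  · have hk : kernelMajorant r (x - y) = (‖x - y‖ ^ 2)⁻¹ := by
      have hmem : x - y ∈ ball (0 : EuclideanSpace ℝ (Fin 3)) r := mem_ball_zero_iff.2 h
      simp [kernelMajorant, hmem]
    rw [hk, div_eq_mul_inv]
    calc ‖ω y‖ * (‖x - y‖ ^ 2)⁻¹ ≤ W * (‖x - y‖ ^ 2)⁻¹ := by gcongr; exact hbound y
      _ ≤ _ := le_add_of_nonneg_right hsum0
  · have hr' : r ≤ ‖x - y‖ := not_lt.1 h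
    have hpos : 0 < ‖x - y‖ := hr.trans_le hr'
    have hcomp : ∀ i, (‖x - y‖ ^ 2)⁻¹ ≤ ((max |y i - x i| r) ^ 2)⁻¹ := by
      intro i
      refine inv_anti₀ (by positivity) (pow_le_pow_left₀ (by positivity) (max_le ?_ hr') 2)
      have hxy : (x - y) i = x i - y i := rfl
      calc |y i - x i| = |(x - y) i| := by rw [hxy, abs_sub_comm]
        _ ≤ ‖x - y‖ := abs_apply_le_norm _ _
    calc ‖ω y‖ / ‖x - y‖ ^ 2 = ‖ω y‖ * (‖x - y‖ ^ 2)⁻¹ := div_eq_mul_inv _ _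
      _ ≤ (∑ i, |ω y i|) * (‖x - y‖ ^ 2)⁻¹ := by gcongr; exact norm_le_sum_abs _
      _ = ∑ i, (‖x - y‖ ^ 2)⁻¹ * |ω y i| := by
          rw [Finset.sum_mul]
          exact Finset.sum_congr rfl fun i _ => mul_comm _ _
      _ ≤ ∑ i, ((max |y i - x i| r) ^ 2)⁻¹ * |ω y i| :=
          Finset.sum_le_sum fun i _ => mul_le_mul_of_nonneg_right (hcomp i) (abs_nonneg _)
      _ ≤ _ := le_add_of_nonneg_left (mul_nonneg hW (kernelMajorant_nonneg _ _))

/-- The pointwise splitting in `ℝ≥0∞`: `ofReal (|ω(y)|/|x−y|²) ≤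
ofReal (W · kernelMajorant r (x − y)) + Σᵢ ofReal ((max(|yᵢ − xᵢ|, r))⁻²) ‖ωᵢ(y)‖ₑ`. -/
private theorem ofReal_div_norm_sq_le {ω : EuclideanSpace ℝ (Fin 3) → EuclideanSpace ℝ (Fin 3)}
    {W r : ℝ} (hr : 0 < r) (hW : 0 ≤ W) (hbound : ∀ y, ‖ω y‖ ≤ W)
    (x y : EuclideanSpace ℝ (Fin 3)) :
    ENNReal.ofReal (‖ω y‖ / ‖x - y‖ ^ 2) ≤
      ENNReal.ofReal (W * kernelMajorant r (x - y)) +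
        ∑ i, ENNReal.ofReal (((max |y i - x i| r) ^ 2)⁻¹) * ‖ω y i‖ₑ := by
  refine (ENNReal.ofReal_le_ofReal (div_norm_sq_le hr hW hbound x y)).trans ?_
  rw [ENNReal.ofReal_add (mul_nonneg hW (kernelMajorant_nonneg _ _))
      (Finset.sum_nonneg fun i _ => by positivity),
    ENNReal.ofReal_sum_of_nonneg fun i _ => by positivity]
  refine add_le_add le_rfl (Finset.sum_le_sum fun i _ => le_of_eq ?_)
  rw [ENNReal.ofReal_mul (by positivity), Real.enorm_eq_ofReal_abs]

/-! ### Slicing by the planes normal to a coordinate axis -/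

/-- **Slicing.** If the unsigned flux of the continuous field `ω` through every plane
`R {y₂ = c}` (`R` a linear isometry, normal `R e₂`) is at most `Φ`, then for every coordinate
`i` and every measurable weight `k : ℝ → ℝ≥0∞` of that coordinate,
`∫ k(yᵢ) |ωᵢ(y)| dy ≤ (∫ k) · Φ`: exchange the coordinates `i` and `2` by the volume-preserving
isometry `piLpCongrLeft (swap i 2)`, split `ℝ³ = ℝ × ℝ²` by `cylSplit` (volume preserving),
apply Tonelli, and bound each plane integral
`∫_w |ωᵢ(R(w₀, w₁, t))| = ∫_w |⟪ω(R(w₀, w₁, t)), R e₂⟫|` by `Φ`. -/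
private theorem lintegral_slice_le {ω : EuclideanSpace ℝ (Fin 3) → EuclideanSpace ℝ (Fin 3)}
    (hω : Continuous ω) {Φ : ℝ}
    (hflux : ∀ (R : EuclideanSpace ℝ (Fin 3) ≃ₗᵢ[ℝ] EuclideanSpace ℝ (Fin 3)) (c : ℝ),
      ∫⁻ y : EuclideanSpace ℝ (Fin 2),
        ‖inner ℝ (ω (R (WithLp.toLp 2 ![y 0, y 1, c]))) (R (EuclideanSpace.single 2 1))‖ₑ ≤
          ENNReal.ofReal Φ)
    (i : Fin 3) {k : ℝ → ℝ≥0∞} (hk : Measurable k) :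
    ∫⁻ y, k (y i) * ‖ω y i‖ₑ ≤ (∫⁻ t, k t) * ENNReal.ofReal Φ := by
  -- the coordinate permutation exchanging `i` and `2`, as a linear isometry of `ℝ³`
  obtain ⟨R, hRi, hRsingle⟩ : ∃ R : EuclideanSpace ℝ (Fin 3) ≃ₗᵢ[ℝ] EuclideanSpace ℝ (Fin 3),
      (∀ v : EuclideanSpace ℝ (Fin 3), R v i = v 2) ∧
        R (EuclideanSpace.single 2 1) = EuclideanSpace.single i 1 := by
    refine ⟨LinearIsometryEquiv.piLpCongrLeft 2 ℝ ℝ (Equiv.swap i 2), fun v => ?_, ?_⟩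
    · show v ((Equiv.swap i 2).symm i) = v 2
      rw [Equiv.symm_swap, Equiv.swap_apply_left]
    · simp [EuclideanSpace.single]
  -- Step 1: the change of variables `y = R z`
  have hF : Measurable fun y : EuclideanSpace ℝ (Fin 3) => k (y i) * ‖ω y i‖ₑ := by fun_prop
  have h1 : ∫⁻ y, k (y i) * ‖ω y i‖ₑ = ∫⁻ z, k (z 2) * ‖ω (R z) i‖ₑ := by
    rw [← R.measurePreserving.lintegral_comp hF]
    simp_rw [hRi]
  -- Step 2: the splitting `z = (w₀, w₁, t)`
  have hRc : Continuous fun v : EuclideanSpace ℝ (Fin 3) => R v := R.continuous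
  have hG : Measurable fun v : EuclideanSpace ℝ (Fin 3) => ‖ω (R v) i‖ₑ := by fun_prop
  have h2 : ∫⁻ z, k (z 2) * ‖ω (R z) i‖ₑ =
      ∫⁻ p : ℝ × EuclideanSpace ℝ (Fin 2),
        k (cylSplit.symm p 2) * ‖ω (R (cylSplit.symm p)) i‖ₑ :=
    (measurePreserving_cylSplit_symm.lintegral_comp_emb cylSplit.symm.measurableEmbedding
      (fun z : EuclideanSpace ℝ (Fin 3) => k (z 2) * ‖ω (R z) i‖ₑ)).symm
  -- Step 3: on each plane `{z₂ = t}` the integral is a flux, at most `Φ`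
  have h4 : ∀ t : ℝ, ∫⁻ w : EuclideanSpace ℝ (Fin 2),
      k (cylSplit.symm (t, w) 2) * ‖ω (R (cylSplit.symm (t, w))) i‖ₑ ≤ k t * ENNReal.ofReal Φ := by
    intro t
    simp only [cylSplit_symm_apply_two]
    have hm : Measurable fun w : EuclideanSpace ℝ (Fin 2) => ‖ω (R (cylSplit.symm (t, w))) i‖ₑ :=
      hG.comp (cylSplit.symm.measurable.comp measurable_prodMk_left)
    rw [lintegral_const_mul _ hm]
    refine mul_le_mul_right ((lintegral_congr fun w => ?_).trans_le (hflux R t)) _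
    rw [cylSplit_symm_apply, hRsingle, EuclideanSpace.inner_single_right, one_mul]
    simp
  -- Step 4: Tonelli
  calc ∫⁻ y, k (y i) * ‖ω y i‖ₑ = ∫⁻ z, k (z 2) * ‖ω (R z) i‖ₑ := h1
    _ = ∫⁻ p : ℝ × EuclideanSpace ℝ (Fin 2),
          k (cylSplit.symm p 2) * ‖ω (R (cylSplit.symm p)) i‖ₑ := h2
    _ ≤ ∫⁻ t, ∫⁻ w : EuclideanSpace ℝ (Fin 2),
          k (cylSplit.symm (t, w) 2) * ‖ω (R (cylSplit.symm (t, w))) i‖ₑ :=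
        lintegral_prod_le (fun p : ℝ × EuclideanSpace ℝ (Fin 2) =>
          k (cylSplit.symm p 2) * ‖ω (R (cylSplit.symm p)) i‖ₑ)
    _ ≤ ∫⁻ t, k t * ENNReal.ofReal Φ := lintegral_mono h4
    _ = (∫⁻ t, k t) * ENNReal.ofReal Φ := lintegral_mul_const _ hk

/-! ### The one-dimensional weight -/

/-- **The one-dimensional weight**: `∫_ℝ (max(|t − a|, r))⁻² dt ≤ 4/r` for `r > 0` (in fact
equality: `2r · r⁻²` on `[a − r, a + r]` and `∫_r^∞ h⁻² dh = 1/r` on each side). -/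
private theorem lintegral_inv_max_sq_le {r : ℝ} (hr : 0 < r) (a : ℝ) :
    ∫⁻ t : ℝ, ENNReal.ofReal (((max |t - a| r) ^ 2)⁻¹) ≤ ENNReal.ofReal (4 / r) := by
  have hr0 : r ≠ 0 := hr.ne'
  rw [lintegral_sub_right_eq_self (μ := (volume : Measure ℝ))
    (fun h => ENNReal.ofReal (((max |h| r) ^ 2)⁻¹)) a]
  -- domination by three pieces: the plateau `[-r, r]`, the tail `(r, ∞)` and its mirror image
  have hpt : ∀ h : ℝ, ENNReal.ofReal (((max |h| r) ^ 2)⁻¹) ≤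
      (Icc (-r) r).indicator (fun _ => ENNReal.ofReal ((r ^ 2)⁻¹)) h +
        ((Ioi r).indicator (fun s => ENNReal.ofReal (s ^ (-2 : ℝ))) h +
          (Ioi r).indicator (fun s => ENNReal.ofReal (s ^ (-2 : ℝ))) (-h)) := by
    intro h
    rcases le_or_gt |h| r with habs | habs
    · rw [max_eq_right habs, indicator_of_mem (mem_Icc.2 (abs_le.1 habs))]
      exact le_self_add
    · rw [max_eq_left habs.le]
      rcases le_or_gt 0 h with hh | hh
      · rw [abs_of_nonneg hh] at habs ⊢
        rw [indicator_of_mem (mem_Ioi.2 habs), Real.rpow_neg hh 2, Real.rpow_two]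
        exact le_add_left le_self_add
      · rw [abs_of_neg hh] at habs ⊢
        rw [indicator_of_mem (mem_Ioi.2 habs), Real.rpow_neg (by linarith) 2, Real.rpow_two]
        exact le_add_left le_add_self
  have hmeas1 : Measurable ((Icc (-r) r).indicator fun _ : ℝ => ENNReal.ofReal ((r ^ 2)⁻¹)) :=
    measurable_const.indicator measurableSet_Icc
  have hmeas2 : Measurable ((Ioi r).indicator fun s : ℝ => ENNReal.ofReal (s ^ (-2 : ℝ))) :=
    (measurable_id.pow_const _).ennreal_ofReal.indicator measurableSet_Ioi
  have hI1 : ∫⁻ h, (Icc (-r) r).indicator (fun _ : ℝ => ENNReal.ofReal ((r ^ 2)⁻¹)) h =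
      ENNReal.ofReal (2 / r) := by
    rw [lintegral_indicator_const measurableSet_Icc, Real.volume_Icc,
      ← ENNReal.ofReal_mul (p := (r ^ 2)⁻¹) (by positivity)]
    congr 1
    field_simp
    ring
  have hI2 : ∫⁻ h, (Ioi r).indicator (fun s : ℝ => ENNReal.ofReal (s ^ (-2 : ℝ))) h =
      ENNReal.ofReal (1 / r) := by
    rw [lintegral_indicator measurableSet_Ioi,
      ← ofReal_integral_eq_lintegral_ofReal
        (integrableOn_Ioi_rpow_of_lt (a := -2) (by norm_num) hr)
        (ae_restrict_of_forall_mem measurableSet_Ioi fun s hs =>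
          Real.rpow_nonneg (hr.le.trans (le_of_lt hs)) _),
      integral_Ioi_rpow_of_lt (a := -2) (by norm_num) hr, show (-2 : ℝ) + 1 = -1 by norm_num,
      Real.rpow_neg_one]
    congr 1
    field_simp
  calc ∫⁻ h, ENNReal.ofReal (((max |h| r) ^ 2)⁻¹)
      ≤ ∫⁻ h, ((Icc (-r) r).indicator (fun _ => ENNReal.ofReal ((r ^ 2)⁻¹)) h +
          ((Ioi r).indicator (fun s => ENNReal.ofReal (s ^ (-2 : ℝ))) h +
            (Ioi r).indicator (fun s => ENNReal.ofReal (s ^ (-2 : ℝ))) (-h))) := lintegral_mono hpt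
    _ = ENNReal.ofReal (2 / r) + (ENNReal.ofReal (1 / r) + ENNReal.ofReal (1 / r)) := by
        rw [lintegral_add_left hmeas1, lintegral_add_left hmeas2,
          lintegral_neg_eq_self ((Ioi r).indicator fun s : ℝ => ENNReal.ofReal (s ^ (-2 : ℝ))),
          hI1, hI2]
    _ = ENNReal.ofReal (4 / r) := by
        rw [← ENNReal.ofReal_add (p := 1 / r) (by positivity) (by positivity),
          ← ENNReal.ofReal_add (p := 2 / r) (by positivity) (by positivity)]
        congr 1
        ring

/-! ### The stub -/

/-- **Stub `stub_nearFieldFlux` of the crux `SlicedKelvin.FluxZoom`, line `registered`: the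
near-field Biot–Savart integral at bounded planar flux.** For a continuous field `ω` on `ℝ³`
with `|ω| ≤ W` and unsigned flux `≤ Φ` through every plane `R {y₂ = c}` (`R` a linear
isometry), every `x` and `0 < r ≤ 1`: `y ↦ |ω(y)|/|x−y|²` is integrable on `B(x, 2)` and
`∫_{B(x,2)} |ω(y)|/|x−y|² dy ≤ 4π r W + 12 Φ / r` (inner ball `B(x, r)`: `W · 4πr` by
`lintegral_kernelMajorant`; the rest: `|ω| ≤ Σᵢ |ωᵢ|` and, sliced by the planes `{yᵢ = c}` where
`|x − y|⁻² ≤ max(|c − xᵢ|, r)⁻²`, each component contributes `≤ Φ ∫ max(|h|, r)⁻² dh = 4Φ/r`).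
Unconditional: no named fact is taken as a hypothesis. -/
theorem stub_nearFieldFlux :
    ∀ (ω : EuclideanSpace ℝ (Fin 3) → EuclideanSpace ℝ (Fin 3)), Continuous ω →
      ∀ (W Φ : ℝ), 0 ≤ W → 0 ≤ Φ → (∀ x, ‖ω x‖ ≤ W) →
        (∀ (R : EuclideanSpace ℝ (Fin 3) ≃ₗᵢ[ℝ] EuclideanSpace ℝ (Fin 3)) (c : ℝ),
          ∫⁻ y : EuclideanSpace ℝ (Fin 2),
            ‖inner ℝ (ω (R (WithLp.toLp 2 ![y 0, y 1, c]))) (R (EuclideanSpace.single 2 1))‖ₑ ≤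
              ENNReal.ofReal Φ) →
        ∀ (x : EuclideanSpace ℝ (Fin 3)) (r : ℝ), 0 < r → r ≤ 1 →
          MeasureTheory.IntegrableOn (fun y => ‖ω y‖ / ‖x - y‖ ^ 2) (Metric.ball x 2)
              MeasureTheory.volume ∧
            ∫ y in Metric.ball x 2, ‖ω y‖ / ‖x - y‖ ^ 2 ≤ 4 * Real.pi * r * W + 12 * Φ / r := by
  intro ω hω W Φ hW hΦ hbound hflux x r hr _
  have hmeas : Measurable fun y : EuclideanSpace ℝ (Fin 3) => ‖ω y‖ / ‖x - y‖ ^ 2 := by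
    fun_prop
  -- integrability on the ball: domination by `W · kernelMajorant 2 (x − ·)`
  have hint : IntegrableOn (fun y => ‖ω y‖ / ‖x - y‖ ^ 2) (ball x 2) volume := by
    have hg : Integrable fun y : EuclideanSpace ℝ (Fin 3) => W * kernelMajorant 2 (x - y) :=
      ((integrable_kernelMajorant 2).comp_sub_left x).const_mul W
    refine hg.integrableOn.mono' hmeas.aestronglyMeasurable
      (ae_restrict_of_forall_mem measurableSet_ball fun y hy => ?_)
    rw [Real.norm_of_nonneg (by positivity)]
    have hmem : x - y ∈ ball (0 : EuclideanSpace ℝ (Fin 3)) 2 := by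
      rw [mem_ball_zero_iff, ← dist_eq_norm, dist_comm]
      exact hy
    have hk : kernelMajorant 2 (x - y) = (‖x - y‖ ^ 2)⁻¹ := by simp [kernelMajorant, hmem]
    rw [hk, div_eq_mul_inv]
    exact mul_le_mul_of_nonneg_right (hbound y) (by positivity)
  refine ⟨hint, ?_⟩
  -- pass to the lower Lebesgue integral
  have hnn : 0 ≤ᵐ[volume.restrict (ball x 2)]
      fun y : EuclideanSpace ℝ (Fin 3) => ‖ω y‖ / ‖x - y‖ ^ 2 :=
    Eventually.of_forall fun y => (by positivity : (0 : ℝ) ≤ ‖ω y‖ / ‖x - y‖ ^ 2)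
  rw [integral_eq_lintegral_of_nonneg_ae hnn hint.aestronglyMeasurable]
  refine ENNReal.toReal_le_of_le_ofReal (by positivity) ?_
  -- the inner ball: `∫ W · kernelMajorant r (x − y) dy = 4π r W`
  have hK : ∫⁻ y, ENNReal.ofReal (W * kernelMajorant r (x - y)) =
      ENNReal.ofReal (4 * π * r * W) := by
    have h1 : (fun y : EuclideanSpace ℝ (Fin 3) => ENNReal.ofReal (W * kernelMajorant r (x - y))) =
        fun y => ENNReal.ofReal W * ENNReal.ofReal (kernelMajorant r (x - y)) :=
      funext fun y => ENNReal.ofReal_mul hW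
    rw [h1, lintegral_const_mul' _ _ ENNReal.ofReal_ne_top,
      lintegral_sub_left_eq_self (μ := (volume : Measure (EuclideanSpace ℝ (Fin 3))))
        (fun z => ENNReal.ofReal (kernelMajorant r z)) x,
      lintegral_kernelMajorant hr.le, ← ENNReal.ofReal_mul (p := W) hW]
    congr 1
    ring
  -- each sliced component: `≤ (4/r) Φ`
  have hcomp : ∀ i : Fin 3, ∫⁻ y, ENNReal.ofReal (((max |y i - x i| r) ^ 2)⁻¹) * ‖ω y i‖ₑ ≤
      ENNReal.ofReal (4 * Φ / r) := by
    intro i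
    have hk : Measurable fun t : ℝ => ENNReal.ofReal (((max |t - x i| r) ^ 2)⁻¹) := by fun_prop
    calc ∫⁻ y, ENNReal.ofReal (((max |y i - x i| r) ^ 2)⁻¹) * ‖ω y i‖ₑ
        ≤ (∫⁻ t, ENNReal.ofReal (((max |t - x i| r) ^ 2)⁻¹)) * ENNReal.ofReal Φ :=
          lintegral_slice_le hω hflux i hk
      _ ≤ ENNReal.ofReal (4 / r) * ENNReal.ofReal Φ :=
          mul_le_mul_left (lintegral_inv_max_sq_le hr (x i)) _
      _ = ENNReal.ofReal (4 * Φ / r) := by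
          rw [← ENNReal.ofReal_mul (p := 4 / r) (by positivity)]
          congr 1
          ring
  have hmeasK : Measurable
      fun y : EuclideanSpace ℝ (Fin 3) => ENNReal.ofReal (W * kernelMajorant r (x - y)) :=
    (((measurable_kernelMajorant r).comp (measurable_const.sub measurable_id)).const_mul
      W).ennreal_ofReal
  have hmeasC : ∀ i : Fin 3, Measurable fun y : EuclideanSpace ℝ (Fin 3) =>
      ENNReal.ofReal (((max |y i - x i| r) ^ 2)⁻¹) * ‖ω y i‖ₑ :=
    fun i => by fun_prop
  have h4 : 0 ≤ 4 * Φ / r := by positivity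
  -- assembly
  calc ∫⁻ y in ball x 2, ENNReal.ofReal (‖ω y‖ / ‖x - y‖ ^ 2)
      ≤ ∫⁻ y, ENNReal.ofReal (‖ω y‖ / ‖x - y‖ ^ 2) := setLIntegral_le_lintegral _ _
    _ ≤ ∫⁻ y, (ENNReal.ofReal (W * kernelMajorant r (x - y)) +
          ∑ i, ENNReal.ofReal (((max |y i - x i| r) ^ 2)⁻¹) * ‖ω y i‖ₑ) :=
        lintegral_mono fun y => ofReal_div_norm_sq_le hr hW hbound x y
    _ = (∫⁻ y, ENNReal.ofReal (W * kernelMajorant r (x - y))) +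
          ∑ i, ∫⁻ y, ENNReal.ofReal (((max |y i - x i| r) ^ 2)⁻¹) * ‖ω y i‖ₑ := by
        rw [lintegral_add_left hmeasK, lintegral_finsetSum _ fun i _ => hmeasC i]
    _ ≤ ENNReal.ofReal (4 * π * r * W) + ∑ _i : Fin 3, ENNReal.ofReal (4 * Φ / r) :=
        add_le_add hK.le (Finset.sum_le_sum fun i _ => hcomp i)
    _ = ENNReal.ofReal (4 * π * r * W + 12 * Φ / r) := by
        simp only [Fin.sum_univ_three]
        rw [← ENNReal.ofReal_add (p := 4 * Φ / r) h4 h4,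
          ← ENNReal.ofReal_add (p := 4 * Φ / r + 4 * Φ / r) (by positivity) h4,
          ← ENNReal.ofReal_add (p := 4 * π * r * W) (by positivity) (by positivity)]
        congr 1
        ring

end Summit.NavierStokesRegularity.NavierStokesRegularity.Theorems.FluxZoom.Registered

end
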